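import Literature.NumberTheory.ComplexMultiplication.DadeTausskyZassenhausCubicMaximalOrder
import Literature.NumberTheory.CubicFields.ArtinUnitInequality
import HarnessLib

/-!
# The units of `ℤ[β]`, `β³ + 2β² + 2β + 2 = 0`: `Λ₁^{unit} = {±(β+1)ˡ | l ∈ ℤ}` (HL26b §8, the third [LMFDB23] fact)

Hertling–Larabi [HL26b, §8] «cite (and use without own proof) some facts which [LMFDB23] states on the algebraic
number field `A := ℚ[α]` and its maximal order `Λ_max`»: `A = ℚ[γ]`, `γ` a zero of `t³ − t² + t + 1`,
«`Λ_max = ℤ[γ]`», «`Λ_max^{unit} = {±γ^l | l ∈ ℤ}`», «`|G([Λ_max]_ε)| = (class number of A) = 1`»; with `β := γ − 1`: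
«`0 = β³ + 2β² + 2β + 2`, `Λ_1 := Λ_max = ℤ[β] = ⟨1, β, β²⟩_ℤ`, `Λ_max^{unit} = {±(β+1)^l | l ∈ ℤ}`» (chunk p0024), and
(chunk p0025) «By [LMFDB23] `Λ_1^{unit} = {±(β+1)^l | l ∈ ℤ}`. Observe `β+1 ∉ Λ_2, Λ_3, Λ_4`, `(β+1)² = β² + 2β + 1 ∈ Λ_2,
∉ Λ_3, ∉ Λ_4`, `(β+1)³ ∉ Λ_2, Λ_3, Λ_4`, `(β+1)⁴ = −2β − 3 ∈ Λ_2, Λ_3, Λ_4`, so `Λ_2^{unit} = {±(β+1)^{2l} | l ∈ ℤ}`,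
`[Λ_1^{unit} : Λ_2^{unit}] = 2`, `Λ_3^{unit} = Λ_4^{unit} = {±(β+1)^{4l} | l ∈ ℤ}`,
`[Λ_1^{unit} : Λ_3^{unit}] = [Λ_1^{unit} : Λ_4^{unit}] = 4`.»

The first two [LMFDB23] facts are `mem_adjoin_theta` / `classNumber_eq_one` (`…CubicMaximalOrder`).  THIS FILE PROVES
THE THIRD: every unit of `Λ₁ = ℤ[θ]` (`θ` a root of `X³ + 2X² + 2X + 2` generating the cubic field `K`) is
`±(θ+1)ˡ`, `l ∈ ℤ` — equivalently `−(θ+1)⁻¹ = θ² + θ + 1` is the fundamental unit `> 1` under the real embedding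
(Alaca–Williams, Table 12, row `d(K) = −44`: field `x³ − x² − x − 1`, fundamental unit `θ`; indeed
`u₀ := θ² + θ + 1` satisfies `u₀³ = u₀² + u₀ + 1`, `u0_pow_three`).  From it, HL's unit groups of `Λ_2, Λ_3, Λ_4`.

## The argument (Alaca–Williams, proof of Theorem 13.6.2, run for `d(K) = −44`)

* §1 Under any real embedding `σ`, `s := σθ ∈ (−8/5, −3/2)` (sign changes of the increasing cubic), so
  `x₀ := σ(θ² + θ + 1) = s² + s + 1 ∈ (1, 2)` (private helpers `real_theta_bounds`, `real_u0_bounds`).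
* §2 ARTIN'S INEQUALITY [AlacaWilliams2003, Thm 13.6.1], in the tree as
  `Literature.NumberTheory.CubicFields.abs_discr_le_of_unit` (`|d_K| ≤ 4ε³ + 24` for a unit with real value `ε > 1`
  of a cubic field with a complex place), together with `d_K = −44` (`discr_eq`) and `𝓞_K = Λ₁`: every unit `c` of `Λ₁`
  with `σ c > 1` has `(σ c)³ ≥ 5`, hence `(σ c)² > 2 > x₀` (`five_le_cube`).
* §3 Dirichlet for the order (`exists_generator_units_span₁`: the units of `Λ₁` are `±η^m`), normalised to `σ η > 1`
  (`exists_generator_one_lt`); then `x₀ = σ(±η^m) = η^m` forces `m = 1` (`m ≥ 2` gives `σ η^m ≥ (σ η)² > 2`, `m ≤ 0` gives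
  `≤ 1`), i.e. `η = θ² + θ + 1 = −(θ+1)⁻¹`, and every unit is `±(θ+1)ˡ` (`unit_eq_sign_mul_zpow`,
  `ringOfIntegers_unit_eq_sign_mul_zpow`, and the converse `sign_mul_zpow_isUnit`).
* §4 HL's consequences for `Λ_2 = ⟨1, 2θ, θ²⟩`, `Λ_3 = ⟨1, 2θ, 2θ²⟩`, `Λ_4 = ⟨1, 2θ, 4θ²⟩`, using the membership
  criteria `add_one_pow_mem_spanᵢ_iff` of `…CubicOrders`: `unit_span₂_iff` (`Λ_2^{unit} = ±(θ+1)^{2ℤ}`),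
  `unit_span₃_iff`, `unit_span₄_iff` (`= ±(θ+1)^{4ℤ}`).

## References
* [HL26b] C. Hertling, K. Larabi, arXiv:2602.15748 (2026), §8, chunks p0024–p0025. [HertlingLarabi2026b]
* Ş. Alaca, K. S. Williams, *Introductory Algebraic Number Theory*, CUP (2004), Theorem 13.6.1 (Artin's inequality),
  proof of Theorem 13.6.2 (the certification pattern `1 < u < η²`), Table 12 (row `d(K) = −44`), pp. 275–279.
  [AlacaWilliams2003]
* [LMFDB23] The LMFDB Collaboration, number field 3.1.44.1 (as cited by HL).
-/

noncomputable section

open Polynomial Module NumberField Submodule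

namespace Literature.NumberTheory.ComplexMultiplication.FiniteQAlgebraLattice.DTZCubic

open Literature.NumberTheory.NumberFields

variable {K : Type*} [Field K] [NumberField K] {θ : K}

/-! ## §1 The real root and the unit `u₀ = θ² + θ + 1 = −(θ+1)⁻¹` -/

omit [NumberField K] in
/-- `u₀ := θ² + θ + 1` is the inverse of `−(θ + 1)`. [cite: HertlingLarabi2026b, §8 («`Λ_max^{unit} = {±(β+1)^l | l ∈ ℤ}`»), chunk p0024] -/
theorem u0_mul_neg_add_one (hθ : aeval θ (MonicCubic.poly 2 2 2) = 0) : (θ ^ 2 + θ + 1) * -(θ + 1) = 1 := by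
  linear_combination -(theta_rel_two hθ)

omit [NumberField K] in
/-- `u₀ = θ² + θ + 1` is a root of `x³ − x² − x − 1` (Alaca–Williams' defining polynomial of the field `d(K) = −44`,
Table 12, whose listed fundamental unit is that root). [cite: AlacaWilliams2003, Table 12 (row d(K) = −44)] -/
theorem u0_pow_three (hθ : aeval θ (MonicCubic.poly 2 2 2) = 0) :
    (θ ^ 2 + θ + 1) ^ 3 = (θ ^ 2 + θ + 1) ^ 2 + (θ ^ 2 + θ + 1) + 1 := by
  linear_combination (θ ^ 3 + θ ^ 2 + θ - 1) * theta_rel_two hθ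

omit [NumberField K] in
/-- Under a real embedding `σ`, `s = σθ` is the real root of `t³ + 2t² + 2t + 2`: `−8/5 < s < −3/2`
(`g(−8/5) = −22/125 < 0 < 1/8 = g(−3/2)`, `g` increasing). [folklore] -/
private theorem real_theta_bounds (hθ : aeval θ (MonicCubic.poly 2 2 2) = 0) (σ : K →+* ℝ) :
    -8 / 5 < σ θ ∧ σ θ < -3 / 2 := by
  have h := congrArg σ (theta_rel_two hθ)
  rw [map_add, map_add, map_add, map_mul, map_mul, map_pow, map_pow, map_zero] at h
  have h2 : σ (2 : K) = 2 := map_ofNat σ 2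
  rw [h2] at h
  constructor
  · refine lt_of_not_ge fun hle => ?_
    have hq : 0 ≤ (σ θ + 1 / 5) ^ 2 + 33 / 25 := by positivity
    nlinarith [mul_nonneg (neg_nonneg.2 (by linarith : σ θ + 8 / 5 ≤ 0)) hq]
  · refine lt_of_not_ge fun hle => ?_
    have hq : 0 ≤ (σ θ + 1 / 4) ^ 2 + 19 / 16 := by positivity
    nlinarith [mul_nonneg (by linarith : 0 ≤ σ θ + 3 / 2) hq]

omit [NumberField K] in
/-- Hence `1 < σ(θ² + θ + 1) < 2` under a real embedding `σ` (the step «`1 < u`» of Alaca–Williams' certification; the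
value is the real root `≈ 1.8393` of `x³ − x² − x − 1`, `u0_pow_three`). [folklore] -/
private theorem real_u0_bounds (hθ : aeval θ (MonicCubic.poly 2 2 2) = 0) (σ : K →+* ℝ) :
    1 < σ (θ ^ 2 + θ + 1) ∧ σ (θ ^ 2 + θ + 1) < 2 := by
  obtain ⟨h1, h2⟩ := real_theta_bounds hθ σ
  rw [map_add, map_add, map_pow, map_one]
  constructor
  · nlinarith
  · nlinarith [mul_neg_of_pos_of_neg (by linarith : 0 < σ θ + 8 / 5) (by linarith : σ θ - 3 / 5 < 0)]

/-! ## §2 Artin's inequality at `d_K = −44`: a unit `> 1` under the real embedding has cube `≥ 5` -/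

omit [NumberField K] in
/-- Elements of `Λ₁ = ⟨1, θ, θ²⟩_ℤ` are algebraic integers. [folklore] -/
private theorem isIntegral_of_mem_span₁' (hθ : aeval θ (MonicCubic.poly 2 2 2) = 0) {c : K}
    (hc : c ∈ span ℤ ({1, θ, θ ^ 2} : Set K)) : IsIntegral ℤ c := by
  obtain ⟨u, v, w, rfl⟩ := exists_coords_of_mem_span₁ hc
  have hθi : IsIntegral ℤ θ := MonicCubic.isIntegral_of_aeval hθ
  have hi : ∀ n : ℤ, IsIntegral ℤ (n : K) := fun n => by
    simpa using (isIntegral_algebraMap (R := ℤ) (A := K) (x := n))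
  exact ((hi u).add ((hi v).mul hθi)).add ((hi w).mul (hθi.pow 2))

/-- `K` has a non-real complex embedding (it has exactly one complex place, `nrComplexPlaces_eq_one`). [folklore] -/
private theorem exists_embedding_not_isReal (hθ : aeval θ (MonicCubic.poly 2 2 2) = 0) (h3 : finrank ℚ K = 3) :
    ∃ σ₂ : K →+* ℂ, ∃ z : K, starRingEnd ℂ (σ₂ z) ≠ σ₂ z := by
  classical
  have hc : 0 < InfinitePlace.nrComplexPlaces K := by rw [nrComplexPlaces_eq_one hθ h3]; exact one_pos
  obtain ⟨w⟩ := Fintype.card_pos_iff.mp hc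
  have hw : ¬ ComplexEmbedding.IsReal w.1.embedding := InfinitePlace.isComplex_iff.1 w.2
  exact ⟨w.1.embedding, not_forall.1 fun h => hw (ComplexEmbedding.isReal_iff.2
    (RingHom.ext fun z => by rw [ComplexEmbedding.conjugate_coe_eq]; exact h z))⟩

/-- **Artin's inequality for `K = ℚ(β)`**: a unit `c` of `Λ₁ = 𝓞_K` with real value `σ c > 1` has `(σ c)³ ≥ 5`
(`44 = |d_K| ≤ 4(σ c)³ + 24`, Alaca–Williams Thm 13.6.1 in the tree's form `abs_discr_le_of_unit`).
[cite: AlacaWilliams2003, Theorem 13.6.1] -/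
theorem five_le_cube (hθ : aeval θ (MonicCubic.poly 2 2 2) = 0) (h3 : finrank ℚ K = 3) (σ : K →+* ℝ)
    {c x : K} (hc : c ∈ span ℤ ({1, θ, θ ^ 2} : Set K)) (hx : x ∈ span ℤ ({1, θ, θ ^ 2} : Set K))
    (hcx : c * x = 1) (h1 : 1 < σ c) : 5 ≤ σ c ^ 3 := by
  obtain ⟨σ₂, hσ₂⟩ := exists_embedding_not_isReal hθ h3
  let u : (𝓞 K)ˣ := ⟨⟨c, isIntegral_of_mem_span₁' hθ hc⟩, ⟨x, isIntegral_of_mem_span₁' hθ hx⟩,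
    RingOfIntegers.ext (by simpa using hcx), RingOfIntegers.ext (by simpa [mul_comm] using hcx)⟩
  have huc : ((u : 𝓞 K) : K) = c := rfl
  have h := Literature.NumberTheory.CubicFields.abs_discr_le_of_unit σ σ₂ h3 hσ₂ u (by rw [huc]; exact h1)
  rw [huc, discr_eq hθ h3] at h
  norm_num at h
  linarith

/-! ## §3 The fundamental unit: `Λ₁^{unit} = {±(θ+1)ˡ | l ∈ ℤ}` -/

omit [NumberField K] in
/-- Changing the sign of the generator: units `±η^m` are units `±(−η)^m`. [folklore] -/
private theorem gen_neg {η : K}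
    (hgen : ∀ c x : K, c ∈ span ℤ ({1, θ, θ ^ 2} : Set K) → x ∈ span ℤ ({1, θ, θ ^ 2} : Set K) → c * x = 1 →
      ∃ m : ℤ, c = η ^ m ∨ c = -η ^ m) :
    ∀ c x : K, c ∈ span ℤ ({1, θ, θ ^ 2} : Set K) → x ∈ span ℤ ({1, θ, θ ^ 2} : Set K) → c * x = 1 →
      ∃ m : ℤ, c = (-η) ^ m ∨ c = -(-η) ^ m := by
  intro c x hc hx hcx
  obtain ⟨m, hm⟩ := hgen c x hc hx hcx
  refine ⟨m, ?_⟩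
  rcases Int.even_or_odd m with he | ho
  · rw [he.neg_zpow]; exact hm
  · rw [ho.neg_zpow, neg_neg]; exact hm.symm

omit [NumberField K] in
/-- Inverting the generator: units `±η^m` are units `±(η⁻¹)^m`. [folklore] -/
private theorem gen_inv {η y : K} (hηy : η * y = 1)
    (hgen : ∀ c x : K, c ∈ span ℤ ({1, θ, θ ^ 2} : Set K) → x ∈ span ℤ ({1, θ, θ ^ 2} : Set K) → c * x = 1 →
      ∃ m : ℤ, c = η ^ m ∨ c = -η ^ m) :
    ∀ c x : K, c ∈ span ℤ ({1, θ, θ ^ 2} : Set K) → x ∈ span ℤ ({1, θ, θ ^ 2} : Set K) → c * x = 1 →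
      ∃ m : ℤ, c = y ^ m ∨ c = -y ^ m := by
  intro c x hc hx hcx
  obtain ⟨m, hm⟩ := hgen c x hc hx hcx
  refine ⟨-m, ?_⟩
  rw [eq_inv_of_mul_eq_one_right hηy, inv_zpow', neg_neg]
  exact hm

/-- **A generator `η` of the units of `Λ₁` with `σ η > 1`** (Dirichlet for the order, `exists_generator_units_span₁`,
normalised by `η ↦ ±η^{±1}`; `|σ η| ≠ 1` because `σ(θ² + θ + 1) > 1`).  This is Alaca–Williams' «`K` possesses a
unique fundamental unit `η > 1`» for the order `ℤ[θ]`. [cite: AlacaWilliams2003, proof of Theorem 13.6.2] -/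
theorem exists_generator_one_lt (hθ : aeval θ (MonicCubic.poly 2 2 2) = 0) (h3 : finrank ℚ K = 3)
    (σ : K →+* ℝ) :
    ∃ η y : K, η ∈ span ℤ ({1, θ, θ ^ 2} : Set K) ∧ y ∈ span ℤ ({1, θ, θ ^ 2} : Set K) ∧ η * y = 1 ∧
      (∀ c x : K, c ∈ span ℤ ({1, θ, θ ^ 2} : Set K) → x ∈ span ℤ ({1, θ, θ ^ 2} : Set K) → c * x = 1 →
        ∃ m : ℤ, c = η ^ m ∨ c = -η ^ m) ∧ 1 < σ η := by
  obtain ⟨η, y, hη, hy, hηy, hgen⟩ := exists_generator_units_span₁ hθ h3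
  -- `|σ η| ≠ 1`
  have hu0 : θ ^ 2 + θ + 1 ∈ span ℤ ({1, θ, θ ^ 2} : Set K) :=
    add_mem (add_mem (subset_span (by simp)) (subset_span (by simp))) (one_mem_span₁ θ)
  have hu0' : -(θ + 1) ∈ span ℤ ({1, θ, θ ^ 2} : Set K) :=
    neg_mem (add_mem (subset_span (by simp)) (one_mem_span₁ θ))
  obtain ⟨hx1, -⟩ := real_u0_bounds hθ σ
  have hσηy : σ η * σ y = 1 := by rw [← map_mul, hηy, map_one]
  have habs : |σ η| ≠ 1 := by
    intro h1
    obtain ⟨m, hm⟩ := hgen _ _ hu0 hu0' (u0_mul_neg_add_one hθ)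
    have h2 : |σ (θ ^ 2 + θ + 1)| = 1 := by
      rcases hm with h | h <;> rw [h]
      · rw [map_zpow₀, abs_zpow, h1, one_zpow]
      · rw [map_neg, map_zpow₀, abs_neg, abs_zpow, h1, one_zpow]
    rw [abs_of_pos (by linarith)] at h2
    linarith
  -- a generator of absolute value `> 1`
  have step : ∃ η₁ y₁ : K, η₁ ∈ span ℤ ({1, θ, θ ^ 2} : Set K) ∧ y₁ ∈ span ℤ ({1, θ, θ ^ 2} : Set K) ∧
      η₁ * y₁ = 1 ∧ (∀ c x : K, c ∈ span ℤ ({1, θ, θ ^ 2} : Set K) → x ∈ span ℤ ({1, θ, θ ^ 2} : Set K) →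
        c * x = 1 → ∃ m : ℤ, c = η₁ ^ m ∨ c = -η₁ ^ m) ∧ 1 < |σ η₁| := by
    rcases lt_or_gt_of_ne habs with hlt | hgt
    · refine ⟨y, η, hy, hη, by rw [mul_comm]; exact hηy, gen_inv hηy hgen, ?_⟩
      have hy' : σ y = (σ η)⁻¹ := eq_inv_of_mul_eq_one_right hσηy
      have h0 : σ η ≠ 0 := left_ne_zero_of_mul_eq_one hσηy
      rw [hy', abs_inv]
      exact one_lt_inv_iff₀.2 ⟨abs_pos.2 h0, hlt⟩
    · exact ⟨η, y, hη, hy, hηy, hgen, hgt⟩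
  obtain ⟨η₁, y₁, hη₁, hy₁, hη₁y₁, hgen₁, habs₁⟩ := step
  -- fix the sign
  rcases le_or_gt 0 (σ η₁) with hpos | hneg
  · rw [abs_of_nonneg hpos] at habs₁
    exact ⟨η₁, y₁, hη₁, hy₁, hη₁y₁, hgen₁, habs₁⟩
  · rw [abs_of_neg hneg] at habs₁
    refine ⟨-η₁, -y₁, neg_mem hη₁, neg_mem hy₁, by rw [neg_mul_neg]; exact hη₁y₁, gen_neg hgen₁, ?_⟩
    rw [map_neg]; exact habs₁

/-- **The normalised generator is `θ² + θ + 1 = −(θ+1)⁻¹`** (Alaca–Williams' certification: `1 < u₀ < η²` and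
`u₀ = ±η^k` force `u₀ = η`; here `η² > 2 > u₀` by Artin's inequality with `d_K = −44`).
[cite: AlacaWilliams2003, proof of Theorem 13.6.2 («the plus sign holds … and `k = 1`; that is, `u = η`»)] -/
theorem generator_eq_u0 (hθ : aeval θ (MonicCubic.poly 2 2 2) = 0) (h3 : finrank ℚ K = 3) (σ : K →+* ℝ)
    {η y : K} (hη : η ∈ span ℤ ({1, θ, θ ^ 2} : Set K)) (hy : y ∈ span ℤ ({1, θ, θ ^ 2} : Set K))
    (hηy : η * y = 1)
    (hgen : ∀ c x : K, c ∈ span ℤ ({1, θ, θ ^ 2} : Set K) → x ∈ span ℤ ({1, θ, θ ^ 2} : Set K) → c * x = 1 →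
      ∃ m : ℤ, c = η ^ m ∨ c = -η ^ m)
    (h1 : 1 < σ η) : η = θ ^ 2 + θ + 1 := by
  have hu0 : θ ^ 2 + θ + 1 ∈ span ℤ ({1, θ, θ ^ 2} : Set K) :=
    add_mem (add_mem (subset_span (by simp)) (subset_span (by simp))) (one_mem_span₁ θ)
  have hu0' : -(θ + 1) ∈ span ℤ ({1, θ, θ ^ 2} : Set K) :=
    neg_mem (add_mem (subset_span (by simp)) (one_mem_span₁ θ))
  obtain ⟨hx1, hx2⟩ := real_u0_bounds hθ σ
  have h5 := five_le_cube hθ h3 σ hη hy hηy h1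
  have hsq : 2 < σ η ^ 2 := by nlinarith
  have hpos : 0 < σ η := by linarith
  obtain ⟨m, hm⟩ := hgen _ _ hu0 hu0' (u0_mul_neg_add_one hθ)
  have hzpos : 0 < σ η ^ m := zpow_pos hpos m
  -- the sign is `+`
  have hm' : θ ^ 2 + θ + 1 = η ^ m := by
    rcases hm with h | h
    · exact h
    · exfalso
      have h' := congrArg σ h
      rw [map_neg, map_zpow₀] at h'
      linarith
  have hval : σ (θ ^ 2 + θ + 1) = σ η ^ m := by rw [hm', map_zpow₀]
  -- `m = 1`
  have hm2 : ¬ 2 ≤ m := fun hle => by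
    have h := zpow_le_zpow_right₀ h1.le hle
    rw [zpow_ofNat, ← hval] at h
    linarith
  have hm0 : ¬ m ≤ 0 := fun hle => by
    have h := zpow_le_zpow_right₀ h1.le hle
    rw [zpow_zero, ← hval] at h
    linarith
  have hm1 : m = 1 := by omega
  rw [hm', hm1, zpow_one]

/-- **`Λ₁^{unit} = {±(β+1)ˡ | l ∈ ℤ}`** — HL's third [LMFDB23] fact, PROVED: every `c ∈ Λ₁ = ℤ[θ]` with an inverse in
`Λ₁` is `(θ+1)^m` or `−(θ+1)^m` for some `m ∈ ℤ`.
[cite: HertlingLarabi2026b, §8 («`Λ_1^{unit} = {±(β+1)^l | l ∈ ℤ}`», cited there from [LMFDB23]), chunk p0025] -/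
theorem unit_eq_sign_mul_zpow (hθ : aeval θ (MonicCubic.poly 2 2 2) = 0) (h3 : finrank ℚ K = 3)
    {c x : K} (hc : c ∈ span ℤ ({1, θ, θ ^ 2} : Set K)) (hx : x ∈ span ℤ ({1, θ, θ ^ 2} : Set K))
    (hcx : c * x = 1) : ∃ m : ℤ, c = (θ + 1) ^ m ∨ c = -(θ + 1) ^ m := by
  classical
  have hodd : Odd (finrank ℚ K) := by rw [h3]; decide
  obtain ⟨w⟩ := Fintype.card_pos_iff.mp (InfinitePlace.nrRealPlaces_pos_of_odd_finrank hodd)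
  obtain ⟨η, y, hη, hy, hηy, hgen, h1⟩ := exists_generator_one_lt hθ h3 (InfinitePlace.embedding_of_isReal w.2)
  have hηu := generator_eq_u0 hθ h3 _ hη hy hηy hgen h1
  -- `η = −(θ+1)⁻¹`
  have hinv : η = -(θ + 1)⁻¹ := by
    rw [hηu, neg_inv]
    exact eq_inv_of_mul_eq_one_left (u0_mul_neg_add_one hθ)
  obtain ⟨k, hk⟩ := hgen c x hc hx hcx
  rw [hinv] at hk
  refine ⟨-k, ?_⟩
  rcases Int.even_or_odd k with he | ho
  · rw [he.neg_zpow, inv_zpow'] at hk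
    exact hk
  · rw [ho.neg_zpow, inv_zpow', neg_neg] at hk
    exact hk.symm

/-- The same for the maximal order: **every unit of `𝓞_K` is `±(θ+1)^m`** (`𝓞_K = ℤ[θ] = Λ₁`, `mem_span₁_of_isIntegral`);
«`Λ_max^{unit} = {±(β+1)^l | l ∈ ℤ}`». [cite: HertlingLarabi2026b, §8 («`Λ_max^{unit} = {±(β+1)^l | l ∈ ℤ}`»), chunk p0024] -/
theorem ringOfIntegers_unit_eq_sign_mul_zpow (hθ : aeval θ (MonicCubic.poly 2 2 2) = 0) (h3 : finrank ℚ K = 3)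
    (u : (𝓞 K)ˣ) : ∃ m : ℤ, ((u : 𝓞 K) : K) = (θ + 1) ^ m ∨ ((u : 𝓞 K) : K) = -(θ + 1) ^ m := by
  refine unit_eq_sign_mul_zpow hθ h3 (x := (((u⁻¹ : (𝓞 K)ˣ) : 𝓞 K) : K))
    (mem_span₁_of_isIntegral hθ h3 (u : 𝓞 K).isIntegral_coe)
    (mem_span₁_of_isIntegral hθ h3 ((u⁻¹ : (𝓞 K)ˣ) : 𝓞 K).isIntegral_coe) ?_
  rw [← map_mul, ← Units.val_mul, mul_inv_cancel, Units.val_one, map_one]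

/-! ### The converse and the unit groups of `Λ_2, Λ_3, Λ_4` -/

omit [NumberField K] in
/-- In a multiplicatively closed `ℤ`-lattice containing `1`, integer powers of an element with inverse in the lattice
stay in the lattice. [folklore] -/
private theorem zpow_mem_of_mul_eq_one {Λ : Submodule ℤ K} (h1 : (1 : K) ∈ Λ) (hmul : Λ * Λ ≤ Λ) {a b : K}
    (ha : a ∈ Λ) (hb : b ∈ Λ) (hab : a * b = 1) (l : ℤ) : a ^ l ∈ Λ := by
  have hpow : ∀ {d : K}, d ∈ Λ → ∀ n : ℕ, d ^ n ∈ Λ := by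
    intro d hd n
    induction n with
    | zero => rw [pow_zero]; exact h1
    | succ n ih =>
      have h := hmul (Submodule.mul_mem_mul ih hd)
      rwa [← pow_succ] at h
  have hinv : a⁻¹ = b := inv_eq_of_mul_eq_one_right hab
  obtain ⟨n, rfl | rfl⟩ := Int.eq_nat_or_neg l
  · rw [zpow_natCast]; exact hpow ha n
  · rw [zpow_neg, zpow_natCast, ← inv_pow, hinv]; exact hpow hb n

omit [NumberField K] in
/-- `θ + 1 ≠ 0`. [folklore] -/
private theorem theta_add_one_ne_zero (hθ : aeval θ (MonicCubic.poly 2 2 2) = 0) : θ + 1 ≠ 0 :=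
  left_ne_zero_of_mul_eq_one ((add_one_mul_eq_one (theta_rel_two hθ)))

omit [NumberField K] in
/-- Units `±(θ+1)^m` of a sub-order: if `(θ+1)^m` and `(θ+1)^{−m}` lie in a lattice `Λ`, closed under negation, then
`c = ±(θ+1)^m` is a unit of `Λ` with inverse `±(θ+1)^{−m}`. [folklore] -/
private theorem sign_mul_zpow_unit_of_mem (hθ : aeval θ (MonicCubic.poly 2 2 2) = 0) {Λ : Submodule ℤ K} {c : K}
    {m : ℤ} (hm : (θ + 1) ^ m ∈ Λ) (hm' : (θ + 1) ^ (-m) ∈ Λ) (hc : c = (θ + 1) ^ m ∨ c = -(θ + 1) ^ m) :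
    c ∈ Λ ∧ ∃ x ∈ Λ, c * x = 1 := by
  have hne : (θ + 1) ^ m ≠ 0 := zpow_ne_zero m (theta_add_one_ne_zero hθ)
  have hprod : (θ + 1) ^ m * (θ + 1) ^ (-m) = 1 := by rw [zpow_neg, mul_inv_cancel₀ hne]
  rcases hc with rfl | rfl
  · exact ⟨hm, _, hm', hprod⟩
  · exact ⟨neg_mem hm, _, neg_mem hm', by rw [neg_mul_neg]; exact hprod⟩

/-- **`Λ₁^{unit} = {±(θ+1)ˡ | l ∈ ℤ}` as an equivalence**: `c ∈ Λ₁` has an inverse in `Λ₁` iff `c = ±(θ+1)^m`.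
[cite: HertlingLarabi2026b, §8 («`Λ_1^{unit} = {±(β+1)^l | l ∈ ℤ}`»), chunk p0025] -/
theorem unit_span₁_iff (hθ : aeval θ (MonicCubic.poly 2 2 2) = 0) (h3 : finrank ℚ K = 3) (c : K) :
    (c ∈ span ℤ ({1, θ, θ ^ 2} : Set K) ∧ ∃ x ∈ span ℤ ({1, θ, θ ^ 2} : Set K), c * x = 1) ↔
      ∃ m : ℤ, c = (θ + 1) ^ m ∨ c = -(θ + 1) ^ m := by
  have hβ := theta_rel_two hθ
  have hθ1 : θ + 1 ∈ span ℤ ({1, θ, θ ^ 2} : Set K) := add_mem (subset_span (by simp)) (one_mem_span₁ θ)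
  have hθ1' : -(θ ^ 2 + θ + 1) ∈ span ℤ ({1, θ, θ ^ 2} : Set K) :=
    neg_mem (add_mem (add_mem (subset_span (by simp)) (subset_span (by simp))) (one_mem_span₁ θ))
  have hz : ∀ m : ℤ, (θ + 1) ^ m ∈ span ℤ ({1, θ, θ ^ 2} : Set K) :=
    zpow_mem_of_mul_eq_one (one_mem_span₁ θ) (span₁_mul_le hβ) hθ1 hθ1' (add_one_mul_eq_one hβ)
  constructor
  · rintro ⟨hc, x, hx, hcx⟩
    exact unit_eq_sign_mul_zpow hθ h3 hc hx hcx
  · rintro ⟨m, hm⟩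
    exact sign_mul_zpow_unit_of_mem hθ (hz m) (hz (-m)) hm

omit [NumberField K] in
/-- From `c = ±(θ+1)^m` with `c` and its inverse in a lattice `Λ`: `(θ+1)^{|m|} ∈ Λ`. [folklore] -/
private theorem pow_natAbs_mem (hθ : aeval θ (MonicCubic.poly 2 2 2) = 0) {Λ : Submodule ℤ K} {c x : K}
    (hc : c ∈ Λ) (hx : x ∈ Λ) (hcx : c * x = 1) {m : ℤ} (hm : c = (θ + 1) ^ m ∨ c = -(θ + 1) ^ m) :
    (θ + 1) ^ m.natAbs ∈ Λ := by
  have hne : (θ + 1) ^ m ≠ 0 := zpow_ne_zero m (theta_add_one_ne_zero hθ)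
  -- `(θ+1)^m ∈ Λ` and `(θ+1)^{-m} ∈ Λ`
  have h1 : (θ + 1) ^ m ∈ Λ := by
    rcases hm with h | h
    · rw [← h]; exact hc
    · rw [show (θ + 1) ^ m = -c by rw [h, neg_neg]]; exact neg_mem hc
  have h2 : (θ + 1) ^ (-m) ∈ Λ := by
    have hxe : x = c⁻¹ := eq_inv_of_mul_eq_one_right hcx
    rcases hm with h | h
    · rw [zpow_neg, ← h, ← hxe]; exact hx
    · have : (θ + 1) ^ (-m) = -x := by rw [hxe, h, inv_neg, neg_neg, zpow_neg]
      rw [this]; exact neg_mem hx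
  rcases Int.natAbs_eq m with h | h
  · have := h1; rw [h, zpow_natCast] at this; exact this
  · have := h2; rw [h, neg_neg, zpow_natCast] at this; exact this

/-- **`Λ_2^{unit} = {±(β+1)^{2l} | l ∈ ℤ}`** (so `[Λ_1^{unit} : Λ_2^{unit}] = 2`): `c ∈ Λ_2 = ⟨1, 2θ, θ²⟩` has an inverse
in `Λ_2` iff `c = ±(θ+1)^m` with `2 ∣ m`.
[cite: HertlingLarabi2026b, §8 («`Λ_2^{unit} = {±(β+1)^{2l} | l ∈ ℤ}`, `[Λ_1^{unit} : Λ_2^{unit}] = 2`»), chunk p0025] -/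
theorem unit_span₂_iff (hθ : aeval θ (MonicCubic.poly 2 2 2) = 0) (h3 : finrank ℚ K = 3) (c : K) :
    (c ∈ span ℤ ({1, 2 * θ, θ ^ 2} : Set K) ∧ ∃ x ∈ span ℤ ({1, 2 * θ, θ ^ 2} : Set K), c * x = 1) ↔
      ∃ m : ℤ, 2 ∣ m ∧ (c = (θ + 1) ^ m ∨ c = -(θ + 1) ^ m) := by
  have hβ := theta_rel_two hθ
  have hli := linearIndependent_one_theta_sq hθ h3
  constructor
  · rintro ⟨hc, x, hx, hcx⟩
    obtain ⟨m, hm⟩ := unit_eq_sign_mul_zpow hθ h3 (span₂_le_span₁ θ hc) (span₂_le_span₁ θ hx) hcx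
    refine ⟨m, ?_, hm⟩
    have h := (add_one_pow_mem_span₂_iff hβ hli m.natAbs).1 (pow_natAbs_mem hθ hc hx hcx hm)
    exact Int.natAbs_dvd_natAbs.1 (by simpa using h)
  · rintro ⟨m, ⟨l, rfl⟩, hm⟩
    -- `(θ+1)² ∈ Λ_2` with inverse `(θ² + θ + 1)² ∈ Λ_2`
    have h2 : (θ + 1) ^ 2 ∈ span ℤ ({1, 2 * θ, θ ^ 2} : Set K) := (add_one_pow_mem_span₂_iff hβ hli 2).2 ⟨1, rfl⟩
    have h2' : (θ ^ 2 + θ + 1) ^ 2 ∈ span ℤ ({1, 2 * θ, θ ^ 2} : Set K) := by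
      rw [show (θ ^ 2 + θ + 1) ^ 2 = ((1 : ℤ) : K) + ((0 : ℤ) : K) * θ + ((1 : ℤ) : K) * θ ^ 2 by
        push_cast; linear_combination θ * hβ, mem_span₂_iff hli]
      norm_num
    have hprod : (θ + 1) ^ 2 * (θ ^ 2 + θ + 1) ^ 2 = 1 := by
      rw [← mul_pow, show (θ + 1) * (θ ^ 2 + θ + 1) = -1 by linear_combination hβ]
      norm_num
    have hz : ∀ l : ℤ, (θ + 1) ^ (2 * l) ∈ span ℤ ({1, 2 * θ, θ ^ 2} : Set K) := fun l => by
      rw [zpow_mul, zpow_ofNat]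
      exact zpow_mem_of_mul_eq_one (one_mem_span₂ θ) (span₂_mul_le hβ) h2 h2' hprod l
    exact sign_mul_zpow_unit_of_mem hθ (hz l) (by rw [show -(2 * l) = 2 * (-l) by ring]; exact hz (-l)) hm

/-- **`Λ_3^{unit} = {±(β+1)^{4l} | l ∈ ℤ}`** (index `4` in `Λ_1^{unit}`): `c ∈ Λ_3 = ⟨1, 2θ, 2θ²⟩` has an inverse in `Λ_3`
iff `c = ±(θ+1)^m` with `4 ∣ m`.
[cite: HertlingLarabi2026b, §8 («`Λ_3^{unit} = Λ_4^{unit} = {±(β+1)^{4l} | l ∈ ℤ}`, `[Λ_1^{unit} : Λ_3^{unit}] = 4`»), chunk p0025] -/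
theorem unit_span₃_iff (hθ : aeval θ (MonicCubic.poly 2 2 2) = 0) (h3 : finrank ℚ K = 3) (c : K) :
    (c ∈ span ℤ ({1, 2 * θ, 2 * θ ^ 2} : Set K) ∧ ∃ x ∈ span ℤ ({1, 2 * θ, 2 * θ ^ 2} : Set K), c * x = 1) ↔
      ∃ m : ℤ, 4 ∣ m ∧ (c = (θ + 1) ^ m ∨ c = -(θ + 1) ^ m) := by
  have hβ := theta_rel_two hθ
  have hli := linearIndependent_one_theta_sq hθ h3
  constructor
  · rintro ⟨hc, x, hx, hcx⟩
    obtain ⟨m, hm⟩ := unit_eq_sign_mul_zpow hθ h3 (span₂_le_span₁ θ (span₃_le_span₂ θ hc))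
      (span₂_le_span₁ θ (span₃_le_span₂ θ hx)) hcx
    refine ⟨m, ?_, hm⟩
    have h := (add_one_pow_mem_span₃_iff hβ hli m.natAbs).1 (pow_natAbs_mem hθ hc hx hcx hm)
    exact Int.natAbs_dvd_natAbs.1 (by simpa using h)
  · rintro ⟨m, ⟨l, rfl⟩, hm⟩
    have h4 : (θ + 1) ^ 4 ∈ span ℤ ({1, 2 * θ, 2 * θ ^ 2} : Set K) := (add_one_pow_mem_span₃_iff hβ hli 4).2 ⟨1, rfl⟩
    have h4' : ((5 : ℤ) : K) + ((2 : ℤ) : K) * θ + ((4 : ℤ) : K) * θ ^ 2 ∈ span ℤ ({1, 2 * θ, 2 * θ ^ 2} : Set K) := by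
      rw [mem_span₃_iff hli]; norm_num
    have hprod : (θ + 1) ^ 4 * (((5 : ℤ) : K) + ((2 : ℤ) : K) * θ + ((4 : ℤ) : K) * θ ^ 2) = 1 := by
      rw [add_one_pow_four hβ]; exact pow_four_mul_inv_eq_one hβ
    have hz : ∀ l : ℤ, (θ + 1) ^ (4 * l) ∈ span ℤ ({1, 2 * θ, 2 * θ ^ 2} : Set K) := fun l => by
      rw [zpow_mul, zpow_ofNat]
      exact zpow_mem_of_mul_eq_one (one_mem_span₃ θ) (span₃_mul_le hβ) h4 h4' hprod l
    exact sign_mul_zpow_unit_of_mem hθ (hz l) (by rw [show -(4 * l) = 4 * (-l) by ring]; exact hz (-l)) hm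

/-- **`Λ_4^{unit} = {±(β+1)^{4l} | l ∈ ℤ}`** (index `4` in `Λ_1^{unit}`): `c ∈ Λ_4 = ⟨1, 2θ, 4θ²⟩` has an inverse in `Λ_4`
iff `c = ±(θ+1)^m` with `4 ∣ m`.
[cite: HertlingLarabi2026b, §8 («`Λ_3^{unit} = Λ_4^{unit} = {±(β+1)^{4l} | l ∈ ℤ}`, `[Λ_1^{unit} : Λ_4^{unit}] = 4`»), chunk p0025] -/
theorem unit_span₄_iff (hθ : aeval θ (MonicCubic.poly 2 2 2) = 0) (h3 : finrank ℚ K = 3) (c : K) :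
    (c ∈ span ℤ ({1, 2 * θ, 4 * θ ^ 2} : Set K) ∧ ∃ x ∈ span ℤ ({1, 2 * θ, 4 * θ ^ 2} : Set K), c * x = 1) ↔
      ∃ m : ℤ, 4 ∣ m ∧ (c = (θ + 1) ^ m ∨ c = -(θ + 1) ^ m) := by
  have hβ := theta_rel_two hθ
  have hli := linearIndependent_one_theta_sq hθ h3
  constructor
  · rintro ⟨hc, x, hx, hcx⟩
    obtain ⟨m, hm⟩ := unit_eq_sign_mul_zpow hθ h3 (span₂_le_span₁ θ (span₃_le_span₂ θ (span₄_le_span₃ θ hc)))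
      (span₂_le_span₁ θ (span₃_le_span₂ θ (span₄_le_span₃ θ hx))) hcx
    refine ⟨m, ?_, hm⟩
    have h := (add_one_pow_mem_span₄_iff hβ hli m.natAbs).1 (pow_natAbs_mem hθ hc hx hcx hm)
    exact Int.natAbs_dvd_natAbs.1 (by simpa using h)
  · rintro ⟨m, ⟨l, rfl⟩, hm⟩
    have h4 : (θ + 1) ^ 4 ∈ span ℤ ({1, 2 * θ, 4 * θ ^ 2} : Set K) := (add_one_pow_mem_span₄_iff hβ hli 4).2 ⟨1, rfl⟩
    have h4' : ((5 : ℤ) : K) + ((2 : ℤ) : K) * θ + ((4 : ℤ) : K) * θ ^ 2 ∈ span ℤ ({1, 2 * θ, 4 * θ ^ 2} : Set K) := by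
      rw [mem_span₄_iff hli]; norm_num
    have hprod : (θ + 1) ^ 4 * (((5 : ℤ) : K) + ((2 : ℤ) : K) * θ + ((4 : ℤ) : K) * θ ^ 2) = 1 := by
      rw [add_one_pow_four hβ]; exact pow_four_mul_inv_eq_one hβ
    have hz : ∀ l : ℤ, (θ + 1) ^ (4 * l) ∈ span ℤ ({1, 2 * θ, 4 * θ ^ 2} : Set K) := fun l => by
      rw [zpow_mul, zpow_ofNat]
      exact zpow_mem_of_mul_eq_one (one_mem_span₄ θ) (span₄_mul_le hβ) h4 h4' hprod l
    exact sign_mul_zpow_unit_of_mem hθ (hz l) (by rw [show -(4 * l) = 4 * (-l) by ring]; exact hz (-l)) hm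

end Literature.NumberTheory.ComplexMultiplication.FiniteQAlgebraLattice.DTZCubic

end
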